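import Summits.QuantumFields.YangMills.Theorems.RevelationMartingaleMeanDeviationBoundedDepth
import Summits.QuantumFields.YangMills.Theorems.BalabanUVNodesN21LocalAveragedRegularityLevels
import Literature.MathematicalPhysics.QuantumFieldTheory.Balaban1983to89.T3Thresholds
import HarnessLib

/-!
# Line «revelation_martingale» on crux `HistoryTailL` (stmt-QuantumFields-19936), centring stub `stub_meanDeviationShallow` — LETTERS for
# `MeanDeviationL` AT LOGARITHMIC DEPTH (sibling `RevelationMartingaleMeanDeviationLogDepth`)

Cell `ym3-torus` (YM ladder rung R3 = continuum SU(2) Yang–Mills on the three-torus — a RUNG, NOT the Clay problem), width seat `ym-ust-19936-w3` gen 9.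
The deterministic, covering and real-analysis letters behind ★ `RevelationMartingaleMeanDeviationLogDepth.meanDeviation_logDepth`:

* §1 `dist1_iter_lt_of_plaqSmallOn_box` — [Balaban1985Averaging] Prop. 2 LOCAL and `k`-UNIFORM at one plaquette, BY NAME
  (✓ `N21LocalAveragedRegularity.plaqSmallOn_iter_blockAvg_eml_loc_pow` along the chain of block centres below the corner `p₋`): fine plaquettes
  `α₀L^{−2j}`-small on `boxRegion (xs 0) (L^j((d+4)L+2))` ⇒ `|Ū^j(∂p) − 1| < α₀ + 2C₀α₀²` — NO `(151L²)^j` loss.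
* §2 `gibbsK_real_le_sum_box` — the coarse event `{θ' ≤ |Ū^j(∂p) − 1|}` is covered by the fine tails over that box (union bound, no measurability);
  `card_box_le` — the box has `≤ 243(7L+2)³·L^{3j}` plaquettes.
* §3 `exists_threshold_exp_le` (the coupling threshold `X₀(A, b₀, q)`: `A·e^{qu} ≤ (b₀/8)e^{c b₀²(1+u)²}` for `u ≥ X₀`), `two_mul_card_mul_term_le`
  (box count and `(√β_K)^9` against the Gaussian factor), `exp_gauss_le` (the exponent `β_K a²/4 = (9/1600)p²L^{−3j} ≥ (9/1600)b₀²y` under the depth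
  hypothesis `L^{3j} ≤ y = (1 + log g⁻¹)^{p₀}`).

HONEST.  Letters only; nothing of `MeanDeviationShallowL`/`MeanDeviationL`, the crux `HistoryTailL`, the rung R3, d = 4, a continuum limit or a mass gap is
proved here.  YM₃ on T³ is rung R3, NOT the Clay problem.

References: T. Bałaban, CMP **98** (1985) 17–51 [Balaban1985Averaging] (Prop. 2 (52)–(54) p.26); CMP **102** (1985) 255–275 [Balaban1985UV3]
((7) p.257, (71) p.273); CMP **109** (1987) 249–301 [Balaban1987RG1] ((0.3) p.252).
-/

noncomputable section

open MeasureTheory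
open scoped BigOperators
open Literature.MathematicalPhysics.QuantumFieldTheory.Balaban1983to89
open Literature.MathematicalPhysics.QuantumFieldTheory.Balaban1983to89.T3ContinuumYM3Torus
open Literature.MathematicalPhysics.QuantumFieldTheory.Balaban1983to89.T3UnitScaleTilt
open Literature.MathematicalPhysics.QuantumFieldTheory.Balaban1983to89.T3UnitLawDensityEML (ℰp)
open Literature.MathematicalPhysics.QuantumFieldTheory.Balaban1983to89.T3FinestHeightTail
  (gibbsMeasure_real_dist1_ge_le beta_mul_θBal_sq)
open Literature.MathematicalPhysics.QuantumFieldTheory.Balaban1983to89.T3Thresholds (exists_gamma_forall_θBal_le coupling_le_one)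
open Literature.MathematicalPhysics.QuantumFieldTheory.Balaban1983to89.T3ThresholdSmallness (sqrt_coupling_pos_le)
open Literature.MathematicalPhysics.QuantumFieldTheory.Balaban1983to89.T3UpperLiftSplit (scheme_β_eq)
open Literature.MathematicalPhysics.QuantumFieldTheory.Balaban1983to89.ExpMeanLog (deltaSU expMeanLogSU)
open Literature.MathematicalPhysics.QuantumFieldTheory.Balaban1983to89.BlockAveraging (blockAvg)
open Literature.MathematicalPhysics.QuantumFieldTheory.Balaban1983to89.T4PairDerivBridge (dist1_le_two_specialUnitaryGroup)
open Summit.QuantumFields.YangMills.BalabanUVNodes.N20LCSAvgDominationRegion (boxRegion mem_boxRegion card_boxRegion_le)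
open Summit.QuantumFields.YangMills.Theorems.N21LocalAveragedRegularity (exists_embChain plaqSmallOn_iter_blockAvg_eml_loc_pow)
open Summit.QuantumFields.YangMills.Theorems.HistoryTailBoundedHeight (scheme_β_add one_le_scheme_β θBal_nonneg' third_le_deltaSU_two)
open Summit.QuantumFields.YangMills.Theorems.HistoryTailBoundedHeightLocal (card_planePairs)
open Summit.QuantumFields.YangMills.Theorems.RevelationMartingaleMeanDeviationBoundedDepth (integral_le_add_mul_measureReal_ge')
namespace Summit.QuantumFields.YangMills.Theorems.RevelationMartingaleMeanDeviationLogDepthLetters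

variable (F : T3Family)

/-! ## §1 The deterministic step at one plaquette: [Balaban1985Averaging] Prop. 2, local and `k`-uniform, below the corner of `p` -/

section Deterministic

/-- **SMALL FINE PLAQUETTES ON THE BOX BELOW `p₋` ⇒ SMALL AVERAGED PLAQUETTE AT `p`** (Prop. 2 (52) ⇒ (54), local, `k`-uniform, BY NAME): for a chain
of block centres `xs` with `xs j = p₋` and `α₀` in Prop. 2's window (`C₀(3)α₀ ≤ ⅓`, `2α₀ ≤ 2δ₂/(7L)²`), if every fine plaquette of
`boxRegion (xs 0) (L^j·((3+4)L+2))` satisfies `|U(∂q) − 1| < α₀L^{−2j}` then `|Ū^j(∂p) − 1| < α₀ + 2C₀(3)α₀²`. [cite: Balaban1985Averaging, Prop. 2 (52)–(54) p.26] -/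
theorem dist1_iter_lt_of_plaqSmallOn_box {K j : ℕ} {α₀ : ℝ} (hα : 0 < α₀)
    (hα3 : (143 * (((((F.P K).d + 4 : ℕ) : ℝ)) ^ 2 / 4) ^ 2) * α₀ ≤ 1 / 3)
    (hα2 : 2 * α₀ ≤ 2 * deltaSU (Fin 2) / ((((F.P K).d + 4) * (F.P K).L : ℕ) : ℝ) ^ 2)
    (p : Plaq (F.P K) j) (xs : (i : ℕ) → Site (F.P K) i) (hxj : xs j = p.src) (hxs : ∀ i < j, xs i = emb (xs (i + 1)))
    {U : GaugeField (F.P K) 0 (Matrix.specialUnitaryGroup (Fin 2) ℂ)}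
    (h52 : PlaqSmallOn (↑(boxRegion (xs 0) ((F.P K).L ^ j * (0 + (((F.P K).d + 4) * (F.P K).L + 2)))) : Set (Plaq (F.P K) 0))
      (α₀ * ((((F.P K).L : ℝ) ^ j)⁻¹) ^ 2) U) :
    GaugeGroup.dist1 (GaugeField.plaqHol (Averaging.iter (fun _ => blockAvg (expMeanLogSU (n := Fin 2))) j U) p) <
      α₀ + 2 * (143 * (((((F.P K).d + 4 : ℕ) : ℝ)) ^ 2 / 4) ^ 2) * α₀ ^ 2 := by
  have h54 := plaqSmallOn_iter_blockAvg_eml_loc_pow (n := Fin 2) j hα hα3 hα2 xs hxs 0 h52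
  refine h54 p (Finset.mem_coe.mpr (mem_boxRegion.mpr fun ν => ⟨0, by simp, ?_⟩))
  rw [hxj]; simp

end Deterministic

/-! ## §2 The coarse large-plaquette event at `p` is covered by the fine tails over the box -/

section Cover

/-- **`Gibbs_K{θ' ≤ |Ū^j(∂p) − 1|} ≤ Σ_{q ∈ box} Gibbs_K{α₀L^{−2j} ≤ |U(∂q) − 1|}`** whenever `α₀ + 2C₀(3)α₀² ≤ θ'` and `α₀` is in Prop. 2's window; the
box is `boxRegion (xs 0) (L^j(7L+2))` below the corner of `p` (union bound, no measurability needed). [cite: Balaban1985Averaging, Prop. 2 (52)–(54) p.26] -/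
theorem gibbsK_real_le_sum_box {γ : ℝ} (hγ : 0 ≤ γ) {K j : ℕ} {α₀ θ' : ℝ} (hα : 0 < α₀)
    (hα3 : (143 * (((((F.P K).d + 4 : ℕ) : ℝ)) ^ 2 / 4) ^ 2) * α₀ ≤ 1 / 3)
    (hα2 : 2 * α₀ ≤ 2 * deltaSU (Fin 2) / ((((F.P K).d + 4) * (F.P K).L : ℕ) : ℝ) ^ 2)
    (hθ' : α₀ + 2 * (143 * (((((F.P K).d + 4 : ℕ) : ℝ)) ^ 2 / 4) ^ 2) * α₀ ^ 2 ≤ θ')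
    (p : Plaq (F.P K) j) (xs : (i : ℕ) → Site (F.P K) i) (hxj : xs j = p.src) (hxs : ∀ i < j, xs i = emb (xs (i + 1))) :
    (gibbsK F ℰp γ K).real {U : GaugeField (F.P K) 0 (Matrix.specialUnitaryGroup (Fin 2) ℂ) |
        θ' ≤ GaugeGroup.dist1 (GaugeField.plaqHol (Averaging.iter (fun _ => blockAvg ℰp) j U) p)} ≤
      ∑ q ∈ boxRegion (xs 0) ((F.P K).L ^ j * (0 + (((F.P K).d + 4) * (F.P K).L + 2))),
        (gibbsK F ℰp γ K).real {U : GaugeField (F.P K) 0 (Matrix.specialUnitaryGroup (Fin 2) ℂ) |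
          α₀ * ((((F.P K).L : ℝ) ^ j)⁻¹) ^ 2 ≤ GaugeGroup.dist1 (GaugeField.plaqHol U q)} := by
  classical
  set B := boxRegion (xs 0) ((F.P K).L ^ j * (0 + (((F.P K).d + 4) * (F.P K).L + 2))) with hB
  have hsub : {U : GaugeField (F.P K) 0 (Matrix.specialUnitaryGroup (Fin 2) ℂ) |
        θ' ≤ GaugeGroup.dist1 (GaugeField.plaqHol (Averaging.iter (fun _ => blockAvg ℰp) j U) p)} ⊆
      ⋃ q ∈ B, {U : GaugeField (F.P K) 0 (Matrix.specialUnitaryGroup (Fin 2) ℂ) |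
        α₀ * ((((F.P K).L : ℝ) ^ j)⁻¹) ^ 2 ≤ GaugeGroup.dist1 (GaugeField.plaqHol U q)} := by
    intro U hU
    by_contra hnot
    have hsmall : PlaqSmallOn (↑B : Set (Plaq (F.P K) 0)) (α₀ * ((((F.P K).L : ℝ) ^ j)⁻¹) ^ 2) U := by
      intro q hq
      by_contra hq'
      exact hnot (Set.mem_biUnion (Finset.mem_coe.mpr hq) (not_lt.mp hq'))
    have hlt := dist1_iter_lt_of_plaqSmallOn_box F hα hα3 hα2 p xs hxj hxs hsmall
    have hU' : θ' ≤ GaugeGroup.dist1 (GaugeField.plaqHol (Averaging.iter (fun _ => blockAvg ℰp) j U) p) := hU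
    exact (not_le.mpr (hlt.trans_le hθ')) hU'
  haveI := isProbabilityMeasure_gibbsK F ℰp hγ K
  exact (measureReal_mono hsub (measure_ne_top _ _)).trans (measureReal_biUnion_finset_le B _)

/-- The box below a level-`j` corner has at most `9·(2L^j(7L+2)+1)³ ≤ 243(7L+2)³·L^{3j}` plaquettes. [cite: Balaban1987RG1, (0.3) p.252] -/
theorem card_box_le {K : ℕ} (x : Site (F.P K) 0) (j : ℕ) :
    ((boxRegion x ((F.P K).L ^ j * (0 + (((F.P K).d + 4) * (F.P K).L + 2)))).card : ℝ) ≤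
      243 * (7 * (F.L : ℝ) + 2) ^ 3 * ((F.L : ℝ) ^ j) ^ 3 := by
  have h := card_boxRegion_le x ((F.P K).L ^ j * (0 + (((F.P K).d + 4) * (F.P K).L + 2)))
  have hd : (F.P K).d = 3 := rfl
  have hL : (F.P K).L = F.L := rfl
  rw [hd, hL] at h
  have hL1 : (1 : ℝ) ≤ F.L := by exact_mod_cast F.hL.2.le
  have hρ1 : (1 : ℝ) ≤ (F.L : ℝ) ^ j * (7 * (F.L : ℝ) + 2) := by nlinarith [one_le_pow₀ (n := j) hL1]
  have hcast : ((boxRegion x (F.L ^ j * (0 + ((3 + 4) * F.L + 2)))).card : ℝ) ≤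
      (2 * ((F.L : ℝ) ^ j * (7 * (F.L : ℝ) + 2)) + 1) ^ 3 * 9 := by
    have := h
    calc ((boxRegion x (F.L ^ j * (0 + ((3 + 4) * F.L + 2)))).card : ℝ)
        ≤ (((2 * (F.L ^ j * (0 + ((3 + 4) * F.L + 2))) + 1) ^ 3 * 3 ^ 2 : ℕ) : ℝ) := by exact_mod_cast this
      _ = (2 * ((F.L : ℝ) ^ j * (7 * (F.L : ℝ) + 2)) + 1) ^ 3 * 9 := by push_cast; ring
  refine hcast.trans ?_
  have h3 : 2 * ((F.L : ℝ) ^ j * (7 * (F.L : ℝ) + 2)) + 1 ≤ 3 * ((F.L : ℝ) ^ j * (7 * (F.L : ℝ) + 2)) := by linarith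
  have h0 : 0 ≤ 2 * ((F.L : ℝ) ^ j * (7 * (F.L : ℝ) + 2)) + 1 := by positivity
  calc (2 * ((F.L : ℝ) ^ j * (7 * (F.L : ℝ) + 2)) + 1) ^ 3 * 9 ≤ (3 * ((F.L : ℝ) ^ j * (7 * (F.L : ℝ) + 2))) ^ 3 * 9 := by
        gcongr
    _ = 243 * (7 * (F.L : ℝ) + 2) ^ 3 * ((F.L : ℝ) ^ j) ^ 3 := by ring

end Cover

/-! ## §3 Real-analysis letters -/

section Arith

/-- Threshold: for `A, b₀, c > 0`, `q ≥ 0` there is `X₀ ≥ 0` such that `A·e^{q·u} ≤ (b₀/8)·e^{c·b₀²·(1+u)²}` for every `u ≥ X₀`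
(linear-times-exponential versus Gaussian-in-`(1+u)`). [folklore] -/
theorem exists_threshold_exp_le {A b₀ c q : ℝ} (hA : 0 < A) (hb₀ : 0 < b₀) (hc : 0 < c) (hq : 0 ≤ q) :
    ∃ X₀ : ℝ, 0 ≤ X₀ ∧ ∀ u : ℝ, X₀ ≤ u → A * Real.exp (q * u) ≤ b₀ / 8 * Real.exp (c * b₀ ^ 2 * (1 + u) ^ 2) := by
  set M : ℝ := max 0 (Real.log A - Real.log (b₀ / 8)) with hM
  have hM0 : 0 ≤ M := le_max_left _ _
  have hcb : 0 < c * b₀ ^ 2 := by positivity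
  refine ⟨(q + M) / (c * b₀ ^ 2), by positivity, fun u hu => ?_⟩
  have hu0 : 0 ≤ u := le_trans (by positivity) hu
  have hb8 : 0 < b₀ / 8 := by positivity
  rw [← Real.exp_log hA, ← Real.exp_log hb8, ← Real.exp_add, ← Real.exp_add, Real.exp_le_exp]
  -- `log A + q u ≤ log (b₀/8) + c b₀² (1+u)²`
  have h1 : q + M ≤ c * b₀ ^ 2 * u := by
    have := (div_le_iff₀ hcb).mp hu
    linarith
  have h2 : c * b₀ ^ 2 * u * (1 + u) ≤ c * b₀ ^ 2 * (1 + u) ^ 2 := by nlinarith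
  have h3 : (q + M) * (1 + u) ≤ c * b₀ ^ 2 * u * (1 + u) := mul_le_mul_of_nonneg_right h1 (by linarith)
  have h4 : q * u + M ≤ (q + M) * (1 + u) := by nlinarith
  have h5 : Real.log A - Real.log (b₀ / 8) ≤ M := le_max_right _ _
  linarith

/-- Assembly of the prefactors against the Gaussian factor: with the threshold inequality at `u`, `(1+u)² ≤ y ≤ e^{p₀u}`, `1 ≤ β_K ≤ y·e^{2u}`,
`#box ≤ 243(7L+2)³·y` and the Gaussian factor `E ≤ e^{−c b₀² y}`, one has `2·#box·(C₁(√β_K)^9·E) ≤ ¼·e^{−u}·b₀·y` (`= θ/4`). [folklore] -/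
theorem two_mul_card_mul_term_le {L' C₁ b₀ p₀ u y βK E n : ℝ} (hC₁ : 0 ≤ C₁) (hb₀ : 0 < b₀) (hL' : 0 ≤ L')
    (hthr : 243 * (7 * L' + 2) ^ 3 * C₁ * Real.exp ((6 * p₀ + 11) * u) ≤ b₀ / 8 * Real.exp (9 / 1600 * b₀ ^ 2 * (1 + u) ^ 2))
    (hy1 : 1 ≤ y) (hysq : (1 + u) ^ 2 ≤ y) (hyexp : y ≤ Real.exp (p₀ * u)) (hβK1 : 1 ≤ βK) (hβKle : βK ≤ y * Real.exp (2 * u))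
    (hn : n ≤ 243 * (7 * L' + 2) ^ 3 * y) (hE0 : 0 ≤ E) (hE : E ≤ Real.exp (-(9 / 1600 * b₀ ^ 2 * y))) :
    2 * (n * (C₁ * Real.sqrt βK ^ 9 * E)) ≤ Real.exp (-u) * (b₀ * y) / 4 := by
  have hy0 : 0 < y := one_pos.trans_le hy1
  -- (i) the count `≤ 243(7L+2)³ e^{p₀ u}`
  have hn' : n ≤ 243 * (7 * L' + 2) ^ 3 * Real.exp (p₀ * u) :=
    hn.trans (mul_le_mul_of_nonneg_left hyexp (by positivity))
  -- (ii) the polynomial prefactor `(√βK)^9 ≤ βK^5 ≤ (y e^{2u})^5 ≤ e^{5p₀u} e^{10u}`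
  have hsqrt : Real.sqrt βK ^ 9 ≤ Real.exp (5 * p₀ * u) * Real.exp (10 * u) := by
    have hs1 : 1 ≤ Real.sqrt βK := by rw [← Real.sqrt_one]; exact Real.sqrt_le_sqrt hβK1
    have h9 : Real.sqrt βK ^ 9 ≤ Real.sqrt βK ^ 10 := pow_le_pow_right₀ hs1 (by norm_num)
    have h10 : Real.sqrt βK ^ 10 = βK ^ 5 := by
      rw [show (10 : ℕ) = 2 * 5 from rfl, pow_mul, Real.sq_sqrt (zero_le_one.trans hβK1)]
    refine h9.trans ?_
    rw [h10]
    have hβK0 : 0 ≤ βK := zero_le_one.trans hβK1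
    calc βK ^ 5 ≤ (y * Real.exp (2 * u)) ^ 5 := pow_le_pow_left₀ hβK0 hβKle 5
      _ = y ^ 5 * Real.exp (2 * u) ^ 5 := mul_pow _ _ _
      _ ≤ Real.exp (p₀ * u) ^ 5 * Real.exp (2 * u) ^ 5 :=
          mul_le_mul_of_nonneg_right (pow_le_pow_left₀ hy0.le hyexp 5) (by positivity)
      _ = Real.exp (5 * p₀ * u) * Real.exp (10 * u) := by
          rw [← Real.exp_nat_mul, ← Real.exp_nat_mul]; congr 1 <;> push_cast <;> ring
  -- (iii) combine
  have hstep1 : n * (C₁ * Real.sqrt βK ^ 9 * E) ≤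
      (243 * (7 * L' + 2) ^ 3 * Real.exp (p₀ * u)) *
        (C₁ * (Real.exp (5 * p₀ * u) * Real.exp (10 * u)) * Real.exp (-(9 / 1600 * b₀ ^ 2 * y))) := by
    rcases le_or_gt 0 n with hn0 | hn0
    · gcongr
    · have h1 : n * (C₁ * Real.sqrt βK ^ 9 * E) ≤ 0 :=
        mul_nonpos_of_nonpos_of_nonneg hn0.le (by positivity)
      exact h1.trans (by positivity)
  have hexp3 : Real.exp (p₀ * u) * (Real.exp (5 * p₀ * u) * Real.exp (10 * u)) =
      Real.exp ((6 * p₀ + 11) * u) * Real.exp (-u) := by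
    rw [← Real.exp_add, ← Real.exp_add, ← Real.exp_add]; congr 1; ring
  have hstep2 : (243 * (7 * L' + 2) ^ 3 * Real.exp (p₀ * u)) *
        (C₁ * (Real.exp (5 * p₀ * u) * Real.exp (10 * u)) * Real.exp (-(9 / 1600 * b₀ ^ 2 * y))) =
      (243 * (7 * L' + 2) ^ 3 * C₁ * Real.exp ((6 * p₀ + 11) * u)) *
        (Real.exp (-(9 / 1600 * b₀ ^ 2 * y)) * Real.exp (-u)) := by
    calc (243 * (7 * L' + 2) ^ 3 * Real.exp (p₀ * u)) *
          (C₁ * (Real.exp (5 * p₀ * u) * Real.exp (10 * u)) * Real.exp (-(9 / 1600 * b₀ ^ 2 * y)))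
        = 243 * (7 * L' + 2) ^ 3 * C₁ * (Real.exp (p₀ * u) * (Real.exp (5 * p₀ * u) * Real.exp (10 * u))) *
            Real.exp (-(9 / 1600 * b₀ ^ 2 * y)) := by ring
      _ = 243 * (7 * L' + 2) ^ 3 * C₁ * (Real.exp ((6 * p₀ + 11) * u) * Real.exp (-u)) *
            Real.exp (-(9 / 1600 * b₀ ^ 2 * y)) := by rw [hexp3]
      _ = _ := by ring
  -- the threshold inequality, the Gaussian in `(1+u)²` below the Gaussian in `y`
  have hthr' : 243 * (7 * L' + 2) ^ 3 * C₁ * Real.exp ((6 * p₀ + 11) * u) ≤ b₀ / 8 * Real.exp (9 / 1600 * b₀ ^ 2 * y) := by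
    refine hthr.trans (mul_le_mul_of_nonneg_left (Real.exp_le_exp.mpr ?_) (by positivity))
    exact mul_le_mul_of_nonneg_left hysq (by positivity)
  have hstep3 : (243 * (7 * L' + 2) ^ 3 * C₁ * Real.exp ((6 * p₀ + 11) * u)) *
        (Real.exp (-(9 / 1600 * b₀ ^ 2 * y)) * Real.exp (-u)) ≤ b₀ / 8 * Real.exp (-u) := by
    calc (243 * (7 * L' + 2) ^ 3 * C₁ * Real.exp ((6 * p₀ + 11) * u)) *
          (Real.exp (-(9 / 1600 * b₀ ^ 2 * y)) * Real.exp (-u))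
        ≤ b₀ / 8 * Real.exp (9 / 1600 * b₀ ^ 2 * y) * (Real.exp (-(9 / 1600 * b₀ ^ 2 * y)) * Real.exp (-u)) :=
          mul_le_mul_of_nonneg_right hthr' (by positivity)
      _ = b₀ / 8 * Real.exp (-u) := by
          rw [mul_assoc, ← mul_assoc (Real.exp (9 / 1600 * b₀ ^ 2 * y)), ← Real.exp_add, add_neg_cancel, Real.exp_zero,
            one_mul]
  -- `(b₀/8) e^{-u} ≤ (b₀/8) e^{-u} y`
  have hlast : b₀ / 8 * Real.exp (-u) ≤ Real.exp (-u) * (b₀ * y) / 8 := by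
    have h0 : 0 ≤ b₀ / 8 * Real.exp (-u) := by positivity
    calc b₀ / 8 * Real.exp (-u) = b₀ / 8 * Real.exp (-u) * 1 := (mul_one _).symm
      _ ≤ b₀ / 8 * Real.exp (-u) * y := mul_le_mul_of_nonneg_left hy1 h0
      _ = Real.exp (-u) * (b₀ * y) / 8 := by ring
  linarith [hstep1, hstep2.le, hstep3, hlast]

/-- The Gaussian exponent under the depth hypothesis: with `β_i θ² = P²`, `P = b₀ y` and `(L^j)³ ≤ y`,
`L^j β_i·((3/20)θ·(L^j)⁻²)²/4 = (9/1600)·P²·(L^j)⁻³ ≥ (9/1600)·b₀²·y`. [cite: Balaban1985UV3, (7) p.257 and (71) p.273] -/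
theorem exp_gauss_le {Lj βi θ P b₀ y : ℝ} (hLj : 0 < Lj) (hb₀ : 0 < b₀) (hy : 0 < y) (hβθ : βi * θ ^ 2 = P ^ 2)
    (hPy : P = b₀ * y) (hL3y : Lj ^ 3 ≤ y) :
    Real.exp (-(Lj * βi * (3 / 20 * θ * (Lj⁻¹) ^ 2) ^ 2 / 4)) ≤ Real.exp (-(9 / 1600 * b₀ ^ 2 * y)) := by
  refine Real.exp_le_exp.mpr (neg_le_neg ?_)
  have hkey : Lj * βi * (3 / 20 * θ * (Lj⁻¹) ^ 2) ^ 2 / 4 = 9 / 1600 * (P ^ 2 / Lj ^ 3) := by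
    rw [← hβθ]
    field_simp
    ring
  rw [hkey, show (9 : ℝ) / 1600 * b₀ ^ 2 * y = 9 / 1600 * (b₀ ^ 2 * y) by ring]
  refine mul_le_mul_of_nonneg_left ?_ (by norm_num)
  have h1 : b₀ ^ 2 * y = P ^ 2 / y := by rw [hPy]; field_simp
  rw [h1]
  exact div_le_div_of_nonneg_left (sq_nonneg P) (pow_pos hLj 3) hL3y

end Arith

end Summit.QuantumFields.YangMills.Theorems.RevelationMartingaleMeanDeviationLogDepthLetters

end
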